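import Mathlib
import Literature.Analysis.FluidPDE.GaussianVortexPlanar
import HarnessLib

/-!
# AsymBurgersLinearizedEvenInvertibility

Topic `Literature/Analysis/FluidPDE`. Named literature fact(s) relocated by the gate from `Summits/NavierStokesRegularity/NavierStokesRegularity/Theorems/FilamentSkeletonRssCoreLinearInvertibilityCoreBoundEven.lean`
(accept-time relocation of `[cite]`d propositions written inline in a Summits proposal; human ruling 2026-08-15).
Sources: GallayMaekawa2016, Maekawa2009b.

* `Literature.Analysis.FluidPDE.Maekawa2009_evenSectorInverseBound`
-/

namespace Literature.Analysis.FluidPDE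

open Set Function Filter MeasureTheory Topology
open Literature.Analysis.FluidPDE
open scoped InnerProductSpace Laplacian ContDiff

/-- **Maekawa 2009 (M3AS 19), Lemma 4.1 / estimate (4.1): uniform invertibility of the
linearisation at the Gaussian vortex in the even sector, for every asymmetry `λ ∈ [0,1)`.**
Printed statement (§4, "The linearized problem"; real Hilbert spaces, real-valued functions; *"we
consider the equation `L_{λ,α} h₁ = f₁` for a given `f₁ ∈ 𝒫ᵉ X_λ`. Here `L_{λ,α} = L + λM − αΛ`"*):
*"Lemma 4.1. Let `λ ∈ [0,1)` and `γ ∈ [0,1)`. Then there is a number `Θ = Θ(λ) ≥ 0` such that for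
any `α ∈ ℝ` with `|α| ≥ Θ`, we have for `f₁ ∈ 𝒫ᵉ X_λ`"* the estimates (4.1)–(4.3) on
`h₁ = L_{λ,α}⁻¹ f₁`, *"Here the constants `J₁` and `J₂` are independent of `γ` and `α` with
`|α| ≥ Θ`. For each `λ ∈ [0,1)` the constants `δ₁(|α|,λ,γ)` and `δ₂(|α|,λ,γ)` are bounded with
respect to `|α| ∈ [Θ,∞)` and `γ ∈ [0,1)`, and satisfy `lim_{|α|→∞} δᵢ = 0`"*; (4.1) is the bound of
`‖h₁‖_{Y_λ ∩ W_λ}` (weighted `H¹` with weight `|x|`; §5: *"from (4.1) in Lemma 4.1 we see that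
`H_{λ,α}` maps ... into `Y_λ ∩ W_λ ∩ 𝒫ᵉ X_λ`"*) in terms of the `X_λ`-size of `f₁` (model case
`λ < ½`: Maekawa, JMAA 349 (2009), Lemma 3.1 (3.1),
`‖(L − αΛ + λM)⁻¹ f‖_{Y∩W} ≤ K₁(1−2λ)⁻¹ ‖(−L)^{−1/2} f‖_X`), (4.2)–(4.3) the attenuation of the
non-radial blocks (= Gallay–Maekawa 2016, (4.9)); end of §4.2: *"This estimate leads to the
existence of the bounded inverse of `L_{λ,α}` by the Fredholm alternative theorem"* (through the
right skew-symmetrizer `T` of `Λ` on `𝒫ᵉ X_λ`, Lemma 1.1, and `Ker Λ = Ker ΛT = 𝒫₀ X_λ` on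
`𝒫ᵉ X_λ`, (1.30)). Notation (§1): `L = Δ + ½x·∇ + 1`, `M = ½(x₁∂₁ − x₂∂₂)`, `Λ = Λ_G`,
`Λ_G w = (K∗G, ∇)w + (K∗w, ∇)G`, `K(x) = x^⊥/(2π|x|²)`, `G = (4π)⁻¹e^{−|x|²/4}`;
`G_λ(x) = (1−λ)/(4π) e^{−(1−λ)|x|²/4}` and `X_λ = {w ∈ L²(ℝ²) : G_λ^{−1/2} w ∈ L², ∫ w = 0}`,
`Y_λ = {∂ᵢw ∈ X_λ}`, `W_λ = {G_λ^{−1/2} xᵢ w ∈ L²}` (his (1.9)–(1.12); = Gallay–Maekawa 2016,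
(4.5)–(4.6): `X_λ = L²₀(∞;λ)`); `𝒫ᵉ X_λ = ⊕_{n∈ℤ} 𝒫₂ₙ X_λ` (even angular Fourier modes, i.e.
`w(−x) = w(x)`; (1.15) and §3, first line). Restated in Gallay–Maekawa 2016, §4.1, (4.9) and the
paragraph after it: *"the invertibility of `L_λ − αΛ_G` [in `𝒫ᵉ L²₀(∞;λ)`] ... The argument also
yields uniform estimates on the inverse `(L_λ − αΛ_G)⁻¹`"* for `|α|` large depending on `λ`.
Vendored in the A-PRIORI form `‖w‖_{X_λ} ≤ C(λ) ‖L_{λ,α} w‖_{X_λ}` RESTRICTED to compactly supported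
`C²` even mass-zero `w` — a transparent specialisation: `C²_c(ℝ²) ∩ 𝒫ᵉ X_λ ⊂ D(L_{λ,α})` (on it
`L`, `M` act as the classical differential operators and the closure `Λ` of `Λ_G` by the
Biot–Savart formula, and `L_{λ,α} w ∈ 𝒫ᵉ X_λ`), so `w = L_{λ,α}⁻¹(L_{λ,α} w)` and
`‖w‖_{X_λ} ≤ ‖w‖_{Y_λ∩W_λ} ≤ C(λ) ‖L_{λ,α} w‖_{X_λ}` with `C(λ) = sup_{|α| ≥ Θ}` of the printed
constants. Tree vocabulary: `L + λM = strainedVorticityOperator λ` (Lean index `0` = paper index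
`1`), `K∗G = v^G = gaussVortexVelocity`, `K∗w = biotSavart2D w`, `G = gaussVortexProfile`,
`‖f‖²_{X_λ} = ∫ (gaussWeightLam λ x)⁻¹ f(x)²`. Both signs of `α` are printed (`|α| ≥ Θ`); `C`
depends on `λ` only (and blows up as `λ → 1`, Gallay–Maekawa 2016, Thm. 4.2).
[cite: Maekawa2009b, §4 Lemma 4.1 (4.1); Thm. 1.2 (linear step)]
[cite: GallayMaekawa2016, §4.1 (4.9) and the paragraph after it]
[file Analysis/FluidPDE/AsymBurgersLinearizedEvenInvertibility] -/
def Maekawa2009_evenSectorInverseBound : Prop :=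
  ∀ lam ∈ Set.Ico (0 : ℝ) 1, ∃ Θ C : ℝ, 0 < C ∧ ∀ α : ℝ, Θ ≤ |α| →
    ∀ w : EuclideanSpace ℝ (Fin 2) → ℝ, ContDiff ℝ 2 w → HasCompactSupport w →
      (∀ x, w (-x) = w x) → ∫ x, w x = 0 →
      ∫ x, (gaussWeightLam lam x)⁻¹ * w x ^ 2 ≤
        C ^ 2 * ∫ x, (gaussWeightLam lam x)⁻¹ * (strainedVorticityOperator lam w x -
          α * (⟪gaussVortexVelocity x, gradient w x⟫_ℝ +
            ⟪biotSavart2D w x, gradient gaussVortexProfile x⟫_ℝ)) ^ 2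

end Literature.Analysis.FluidPDE
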